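import Summits.BirchSwinnertonDyer.BirchSwinnertonDyer.Theorems.GenusKolyvaginAtTwoGenusPrimitiveSupplyAtTwoPosDiscShallowKFourPosCellShaTwoRank
import Summits.BirchSwinnertonDyer.BirchSwinnertonDyer.Theorems.GenusKolyvaginAtTwoGenusDeepSupplyAtTwoNegDiscNarrowKFourCellShaStructure
import Summits.BirchSwinnertonDyer.BirchSwinnertonDyer.Theorems.GenusKolyvaginAtTwoGenusDeepSupplyAtTwoNegDiscNarrowKFourCellInvariantClasses
import HarnessLib

/-!
# Route `GenusKolyvaginAtTwo`, crux 25504 (Δ>0 supply `GenusPrimitiveSupplyAtTwoPosDiscShallow`), K₄⁺ CELL: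
# `Ш(E_K/K)[2^∞] ≃ ℤ/2^e × ℤ/2^e`, AND EVERY `Gal(K/ℚ)`-INVARIANT `2`-SELMER CLASS OF `E_K` DESCENDS UNIQUELY TO `Sel₂(E/ℚ)`
# — the Δ>0 twins of the LEAD's K₄ files `…NegDiscNarrowKFourCellShaStructure` (p766296) / `…KFourCellInvariantClasses` (p766389)

Seat `bsd-line-gk2-p5` g35 (cell `bsd-f1-sign2`, WIDTH-5 attach), `--supports stmt-BirchSwinnertonDyer-25504 --as helper`; sequel of g34's
`…PosDiscShallowKFourPosCellShaTwoRank` (p766206: `#Ш(E_K/K)[2] = 4`, `#Sel₂(E_K/K) = 8` on the K₄⁺ cell).  THEOREMS ONLY (no definition, no named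
fact, no `sorry`).  **BSD is NOT proved by this file, no item is closed, the registered stub C⁺‴ is untouched.**  UNCONDITIONAL: unlike the Δ<0
twins (print facts hPT/hEP at the non-silent ramified prime), every prime of `d_K` is SILENT on the Δ>0 frame and the real-place switch is print-free.

The K₄⁺ cell (frame of p766206 §3 verbatim): `E/ℚ` globally minimal, `Δ_E > 0`, `ρ̄_{E,2}` onto, `C(E)` odd, the K₄⁺ clause
`#Sel₂(E) = 4 ∧ ∃ c ∈ Sel₂(E), loc_∞ c ≠ 0`; `K` imaginary quadratic with odd `d_K`, Heegner for `N_E`, `2` split, `σ₀ ∈ Aut(K/ℚ)` non-trivial;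
an elliptic model `Wd = Cd • E^{(d_K)}` with `ord₂ C(Wd) = 0`.

* §1 **`exists_addEquiv_sha_primary_zmod_sq_of_kFourPos`** — with `rank E(K) = 1` and `Ш(E_K/K)[2^∞]` finite:
  `∃ e, Ш(E_K/K)[2^∞] ≃+ ZMod 2^e × ZMod 2^e ∧ #Ш(E_K/K)[2^∞] = 4^e` (p766206 `#Ш[2] = 4` + Cassels–Tate hyperbolicity over `K`
  `exists_addEquiv_prod_self_primaryComponent_sha` + the LEAD's group lemma `KFourCell.exists_addEquiv_zmod_prod_zmod_of_natCard_torsionBy_two_eq_four`).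
* §2 **`natCard_fixedSelmer_eq_four_of_kFourPos`** — `#Sel₂(E_K/K)^{σ₀} = 4` (g34 §2 `= #Sel₂^{rel ∞}(E)` + the real switch `Sel₂^{rel ∞}(E) = Sel₂(E)`
  on the cell, `GenusKolyArch.selmerGroupRelaxedAtInfinityAtTwo_eq_selmerGroup_of_exists_localization_ne_zero`); needs neither the rank nor finiteness of `Ш`.
* §3 **`existsUnique_mem_selmerGroup_resTorsion_eq_of_kFourPos`** — every `m ∈ Sel₂(E_K/K)` with `σ₀·m = m` is `res_K s` for a UNIQUE
  `s ∈ H¹(ℚ, E[2])`, and `s ∈ Sel₂(E/ℚ)` (Kramer's invariant part in the descent-admissible form `GenusKolyArch.mem_selmerGroup_and_conjAct_eq_iff_exists_mem_relaxed`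
  over g34 §1 `descAdmissible_discr_of_allSilentTwin`, the real switch, `res_K` injective as `E(K)[2] = 0`); `ne_zero_iff_of_resTorsion_eq_of_kFourPos`:
  the invariant class is non-zero iff its descent is (LEAD's `KFourCell.resTorsion_eq_zero_iff`).

READING (as on K₄, LEAD-BRIEF-g22 §6).  One Kolyvagin–McCallum block: structure-side the deep witness of C⁺‴ is a SINGLE-deep-prime statement
(`M₁ = M_∞`); U⁺_T reads `e ≤ M₀`, BSD reads `e = M₀`.  On the `M₀ ≥ 1` cell a level-1 deep class `c₁(ℓ)` that is Selmer over `K` and `τ`-invariant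
is `res_K s` for a unique `s ∈ Sel₂(E/ℚ)` — on K₄⁺ ALL FOUR classes of `Sel₂(E/ℚ)` qualify (the ∞-relaxed group IS `Sel₂(E)` here), so
**K₄⁺ at the single deep prime `ℓ` ⟺ `c₁(ℓ) = res_K s` with `s` one of the three non-zero classes of `Sel₂(E/ℚ) ≅ Ш(E/ℚ)[2]`** (rank `0`, `E(ℚ)[2] = 0`).
Nothing here proves K₄⁺ or BSD; `e` is NOT computed.

References: [Cassels1962ArithmeticIV]; [Wall1963QuadraticFormsFiniteGroups] Lemma 7; [McCallumLMS1991] §5 Lemma 5.3; [Kramer1981] Thm. 1, Prop. 3;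
[MazurRubin2010] Lemma 2.2, Lemma 3.2; [GrossLMS1991] §5 (5.1), Prop. 6.2, §11.
-/

set_option linter.dupNamespace false -- `Summit.<P>.<Sub>` repeats `BirchSwinnertonDyer` (D-0017)
set_option autoImplicit false

noncomputable section

open scoped Classical

namespace Summit.BirchSwinnertonDyer.BirchSwinnertonDyer.Theorems.GenusSupplyNarrow.KFourPosCell

open WeierstrassCurve NumberField IsDedekindDomain Field Function
open Literature.NumberTheory.EllipticCurves Literature.NumberTheory.GaloisRepresentations
open Literature.NumberTheory.GaloisCohomology
open Summit.BirchSwinnertonDyer.Rank1Residual.F1Sign2 (DescAdmissible NoRationalTwoTorsion selmerGroupRelaxedAtInfinityAtTwo)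

variable (W : WeierstrassCurve ℚ) [W.IsElliptic] [W.IsGloballyMinimal] (K : Type) [Field K] [NumberField K]

/-! ## §1 The structure of `Ш(E_K/K)[2^∞]` on the K₄⁺ cell -/

/-- **THE STRUCTURE OF `Ш(E/K)[2^∞]` ON THE K₄⁺ CELL: `Ш(E_K/K)[2^∞] ≃ ℤ/2^e × ℤ/2^e` for some `e`, `#Ш(E_K/K)[2^∞] = 4^e`.**  Hypotheses = those of
g34's `natCard_shaTorsionBy_two_baseChange_eq_four_of_kFourPos` (p766206 §3) verbatim: `E/ℚ` globally minimal, `Δ_E > 0`, `ρ̄_{E,2}` onto, `C(E)` odd,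
the K₄⁺ clause `#Sel₂(E) = 4 ∧ ∃ c ∈ Sel₂(E), loc_∞ c ≠ 0`; `K` imaginary quadratic, `d_K` odd, Heegner for `N_E`, `2` split, `σ₀ ≠ 1`;
`Wd = Cd • E^{(d_K)}` elliptic with `ord₂ C(Wd) = 0`; `rank E(K) = 1`; `Ш(E_K/K)[2^∞]` finite.  Proof: Cassels–Tate hyperbolicity `Ш[2^∞] ≃ L × L`
(tree `exists_addEquiv_prod_self_primaryComponent_sha`, unconditional) + `#Ш[2] = 4` (p766206) + the LEAD's group lemma (p766296 §1).  UNCONDITIONAL.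
READING: one Kolyvagin–McCallum block (`M₁ = M_∞`); `e ≤ M₀` (U⁺_T), BSD ⟹ `e = M₀`.  K₄⁺ and BSD are NOT proved by this.
[cite: Cassels1962ArithmeticIV] [cite: Wall1963QuadraticFormsFiniteGroups, Lemma 7] [cite: McCallumLMS1991, §5 Lemma 5.3] [cite: Kramer1981, Thm. 1] -/
theorem exists_addEquiv_sha_primary_zmod_sq_of_kFourPos
    (hpos : 0 < W.Δ) (hs2 : W.HasSurjectiveModNGaloisRep 2) (hTam : Odd W.tamagawaProduct)
    (h4 : Nat.card (W.selmerGroup 2) = 4 ∧ ∃ c ∈ (W.kummerSelmerStructure ((2 : ℕ) : ℤ)).selmerGroup,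
      galoisCohomology.localization (W.torsionGaloisModule ((2 : ℕ) : ℤ)) (Sum.inl Rat.infinitePlace) 1 c ≠ 0)
    (hK : IsImaginaryQuadratic K) (hodd : Odd (discr K)) (hH : SatisfiesHeegnerHypothesis (W.conductorNorm ℤ) K)
    (h2K : ((Ideal.span {(2 : ℤ)}).primesOver (𝓞 K)).ncard = 2) {σ₀ : K ≃ₐ[ℚ] K} (hσ₀ : σ₀ ≠ 1)
    {Wd : WeierstrassCurve ℚ} [Wd.IsElliptic] (Cd : VariableChange ℚ) (hCd : Cd • W.quadraticTwist (discr K : ℚ) = Wd)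
    (hDEF : padicValNat 2 Wd.tamagawaProduct = 0)
    (hrk : (W.baseChange K).mordellWeilRank = 1)
    [Finite (AddCommGroup.primaryComponent (W.baseChange K).sha 2)] :
    ∃ e : ℕ, Nonempty (AddCommGroup.primaryComponent (W.baseChange K).sha 2 ≃+ ZMod (2 ^ e) × ZMod (2 ^ e)) ∧
      Nat.card (AddCommGroup.primaryComponent (W.baseChange K).sha 2) = 4 ^ e := by
  haveI : Fact (Nat.Prime 2) := ⟨Nat.prime_two⟩
  haveI : (W.baseChange K).IsElliptic := inferInstanceAs ((W.map (algebraMap ℚ K)).IsElliptic)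
  -- `#Ш[2] = 4` (g34 p766206), transported to the `2`-primary component
  have h4' := (natCard_shaTorsionBy_two_baseChange_eq_four_of_kFourPos W K hpos hs2 hTam h4 hK hodd hH h2K hσ₀ Cd hCd
    hDEF hrk).1
  have h4'' : Nat.card (AddSubgroup.torsionBy (AddCommGroup.primaryComponent (W.baseChange K).sha 2) ((2 : ℕ) : ℤ)) = 4 := by
    have h := GenusExact.CasselsTateNumberField.natCard_sha_torsionBy_pow_eq_primaryComponent (W.baseChange K) 2 1
    rw [pow_one] at h
    rw [← h]
    exact h4'
  -- hyperbolicity of `Ш[2^∞]` (Cassels–Tate over `K`, unconditional)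
  obtain ⟨L, ⟨eL⟩⟩ := GenusExact.CasselsTateNumberField.exists_addEquiv_prod_self_primaryComponent_sha (W.baseChange K) 2
  -- every element of the primary component is `2`-power torsion
  have hG : ∀ g : AddCommGroup.primaryComponent (W.baseChange K).sha 2, ∃ k : ℕ, 2 ^ k • g = 0 := fun g ↦ by
    obtain ⟨k, hk⟩ := (AddCommGroup.mem_primaryComponent).mp g.2
    exact ⟨k, Subtype.ext (by rw [AddSubgroupClass.coe_nsmul, ZeroMemClass.coe_zero]; exact hk)⟩
  exact KFourCell.exists_addEquiv_zmod_prod_zmod_of_natCard_torsionBy_two_eq_four hG eL h4''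

/-! ## §2 The invariants have order `4` on the K₄⁺ cell -/

omit [W.IsGloballyMinimal] in
/-- The K₄⁺ clause's real class, moved from the structure-language Selmer group to the tree's `Sel₂(E)`: on the K₄⁺ cell
`Sel₂^{rel ∞}(E) = Sel₂(E)` (`GenusKolyArch.selmerGroupRelaxedAtInfinityAtTwo_eq_selmerGroup_of_exists_localization_ne_zero`, `Δ_E > 0`).
[cite: MazurRubin2010, Lemma 3.2] -/
theorem selmerGroupRelaxedAtInfinityAtTwo_eq_selmerGroup_of_kFourPos (hpos : 0 < W.Δ)
    (h4 : Nat.card (W.selmerGroup 2) = 4 ∧ ∃ c ∈ (W.kummerSelmerStructure ((2 : ℕ) : ℤ)).selmerGroup,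
      galoisCohomology.localization (W.torsionGaloisModule ((2 : ℕ) : ℤ)) (Sum.inl Rat.infinitePlace) 1 c ≠ 0) :
    selmerGroupRelaxedAtInfinityAtTwo W = W.selmerGroup ((2 : ℕ) : ℤ) := by
  obtain ⟨c, hc, hne⟩ := h4.2
  have hc' : c ∈ W.selmerGroup ((2 : ℕ) : ℤ) :=
    (SetLike.ext_iff.mp (W.selmerGroup_eq_selmerGroup_kummerSelmerStructure _) c).mpr hc
  exact GenusKolyArch.selmerGroupRelaxedAtInfinityAtTwo_eq_selmerGroup_of_exists_localization_ne_zero W hpos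
    Rat.infinitePlace ⟨c, hc', hne⟩

/-- **`#Sel₂(E_K/K)^{σ₀} = 4` ON THE K₄⁺ CELL.**  `E/ℚ` globally minimal, `Δ_E > 0`, `ρ̄_{E,2}` onto, `C(E)` odd, the K₄⁺ clause; `K` imaginary
quadratic, `d_K` odd, Heegner, `2` split, `σ₀ ≠ 1`; `Wd = Cd • E^{(d_K)}` elliptic with `ord₂ C(Wd) = 0`.  Then the `σ₀`-fixed classes of
`Sel₂(E_K/K)` number exactly `4`: g34 §2 (`= #Sel₂^{rel ∞}(E)`, Kramer's invariant part on the descent-admissible `d_K` of g34 §1) and the real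
switch (`Sel₂^{rel ∞}(E) = Sel₂(E)`, `# = 4`).  No rank / `Ш`-finiteness / print hypothesis.  [cite: Kramer1981, Thm. 1] [cite: MazurRubin2010, Lemma 3.2] -/
theorem natCard_fixedSelmer_eq_four_of_kFourPos
    (hpos : 0 < W.Δ) (hs2 : W.HasSurjectiveModNGaloisRep 2) (hTam : Odd W.tamagawaProduct)
    (h4 : Nat.card (W.selmerGroup 2) = 4 ∧ ∃ c ∈ (W.kummerSelmerStructure ((2 : ℕ) : ℤ)).selmerGroup,
      galoisCohomology.localization (W.torsionGaloisModule ((2 : ℕ) : ℤ)) (Sum.inl Rat.infinitePlace) 1 c ≠ 0)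
    (hK : IsImaginaryQuadratic K) (hodd : Odd (discr K)) (hH : SatisfiesHeegnerHypothesis (W.conductorNorm ℤ) K)
    (h2K : ((Ideal.span {(2 : ℤ)}).primesOver (𝓞 K)).ncard = 2) {σ₀ : K ≃ₐ[ℚ] K} (hσ₀ : σ₀ ≠ 1)
    {Wd : WeierstrassCurve ℚ} [Wd.IsElliptic] (Cd : VariableChange ℚ) (hCd : Cd • W.quadraticTwist (discr K : ℚ) = Wd)
    (hDEF : padicValNat 2 Wd.tamagawaProduct = 0) :
    Nat.card {m : galH1Torsion (W.baseChange K) ((2 : ℕ) : ℤ) //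
        m ∈ selmerGroup (W.baseChange K) ((2 : ℕ) : ℤ) ∧ conjAct W σ₀ ((2 : ℕ) : ℤ) m = m} = 4 := by
  have h2 : Module.finrank ℚ K = 2 := hK.1
  have hsT : W.HasSurjectiveModNGaloisRep ((2 : ℤ) ^ 1) := by rw [pow_one]; exact hs2
  have hT : NoRationalTwoTorsion W := GenusKolyTwin.noRationalTwoTorsion_of_hasSurjectiveModNGaloisRep W hsT
  have hd := descAdmissible_discr_of_allSilentTwin W hK hodd hH h2K hTam Cd hCd hDEF
  have hfix := natCard_fixedSelmer_eq_natCard_selmerGroupRelaxedAtInfinityAtTwo W K hT hd h2 hσ₀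
  rw [selmerGroupRelaxedAtInfinityAtTwo_eq_selmerGroup_of_kFourPos W hpos h4] at hfix
  rw [hfix]
  exact h4.1

/-! ## §3 Unique descent of an invariant `2`-Selmer class of `E_K` to `Sel₂(E/ℚ)` on the K₄⁺ cell -/

omit [W.IsGloballyMinimal] in
/-- `E(K)[2] = 0` on the frame: `ρ̄_{E,2}` onto ⟹ `E(ℚ)[2] = 0` ⟹ no `2`-torsion over the quadratic field `K` (the `2`-division cubic is irreducible,
so it has no root in a quadratic field; tree `EggDoubling.eq_zero_of_two_smul_eq_zero_baseChange`). [cite: Kramer1981, §2] -/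
theorem forall_two_smul_eq_zero_baseChange_of_kFourPos (hs2 : W.HasSurjectiveModNGaloisRep 2) (h2 : Module.finrank ℚ K = 2) :
    ∀ P : (W.baseChange K).toAffine.Point, ((2 : ℕ) : ℤ) • P = 0 → P = 0 := by
  have hsT : W.HasSurjectiveModNGaloisRep ((2 : ℤ) ^ 1) := by rw [pow_one]; exact hs2
  have hT : NoRationalTwoTorsion W := GenusKolyTwin.noRationalTwoTorsion_of_hasSurjectiveModNGaloisRep W hsT
  exact fun P hP ↦ Summit.BirchSwinnertonDyer.Rank1Residual.F1Sign2.EggDoubling.eq_zero_of_two_smul_eq_zero_baseChange W hT h2 P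
    (by rwa [natCast_zsmul] at hP)

/-- **UNIQUE DESCENT OF AN INVARIANT `2`-SELMER CLASS OF `E_K` TO `Sel₂(E/ℚ)` ON THE K₄⁺ CELL** (Δ>0 twin of the LEAD's
`KFourCell.existsUnique_mem_selmerGroup_resTorsion_eq_of_cell`, p766389).  Cell hypotheses: `E/ℚ` globally minimal, `Δ_E > 0`, `ρ̄_{E,2}` onto,
`C(E)` odd, the K₄⁺ clause `#Sel₂(E) = 4 ∧ ∃ c ∈ Sel₂(E), loc_∞ c ≠ 0` VERBATIM; `K` imaginary quadratic, `d_K` odd, Heegner for `N_E`, `2` split;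
`Wd = Cd • E^{(d_K)}` elliptic with `ord₂ C(Wd) = 0`.  Then for EVERY non-trivial `σ₀ ∈ Aut(K/ℚ)` and every `m ∈ Sel₂(E_K/K)` with `σ₀·m = m`
there is a UNIQUE `s ∈ H¹(ℚ, E[2])` with `res_K s = m`, and it lies in `Sel₂(E/ℚ)`.  (g34 §1: `d_K` descent-admissible; Kramer's invariant part
`GenusKolyArch.mem_selmerGroup_and_conjAct_eq_iff_exists_mem_relaxed`: `m = res_K x` with `x ∈ Sel₂^{rel ∞}(E)`; §2: that group IS `Sel₂(E)` on the
cell; uniqueness: `res_K` injective as `E(K)[2] = 0`.)  UNCONDITIONAL.  Home of the level-1 deep Kolyvagin classes `c₁(ℓ)` on the Δ>0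
positive-depth cell.  [cite: Kramer1981, Thm. 1, Prop. 3] [cite: MazurRubin2010, Lemma 3.2] [cite: GrossLMS1991, §5 (5.1), Prop. 6.2, §11] -/
theorem existsUnique_mem_selmerGroup_resTorsion_eq_of_kFourPos
    (hpos : 0 < W.Δ) (hs2 : W.HasSurjectiveModNGaloisRep 2) (hTam : Odd W.tamagawaProduct)
    (h4 : Nat.card (W.selmerGroup 2) = 4 ∧ ∃ c ∈ (W.kummerSelmerStructure ((2 : ℕ) : ℤ)).selmerGroup,
      galoisCohomology.localization (W.torsionGaloisModule ((2 : ℕ) : ℤ)) (Sum.inl Rat.infinitePlace) 1 c ≠ 0)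
    (hK : IsImaginaryQuadratic K) (hodd : Odd (discr K)) (hH : SatisfiesHeegnerHypothesis (W.conductorNorm ℤ) K)
    (h2K : ((Ideal.span {(2 : ℤ)}).primesOver (𝓞 K)).ncard = 2)
    {Wd : WeierstrassCurve ℚ} [Wd.IsElliptic] (Cd : VariableChange ℚ) (hCd : Cd • W.quadraticTwist (discr K : ℚ) = Wd)
    (hDEF : padicValNat 2 Wd.tamagawaProduct = 0)
    {σ₀ : K ≃ₐ[ℚ] K} (hσ₀ : σ₀ ≠ 1)
    {m : galH1Torsion (W.baseChange K) ((2 : ℕ) : ℤ)} (hm : m ∈ selmerGroup (W.baseChange K) ((2 : ℕ) : ℤ))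
    (hσm : conjAct W σ₀ ((2 : ℕ) : ℤ) m = m) :
    ∃! s : galH1Torsion W ((2 : ℕ) : ℤ), resTorsion W K ((2 : ℕ) : ℤ) s = m ∧ s ∈ W.selmerGroup ((2 : ℕ) : ℤ) := by
  have h2 : Module.finrank ℚ K = 2 := hK.1
  have hsT : W.HasSurjectiveModNGaloisRep ((2 : ℤ) ^ 1) := by rw [pow_one]; exact hs2
  have hT : NoRationalTwoTorsion W := GenusKolyTwin.noRationalTwoTorsion_of_hasSurjectiveModNGaloisRep W hsT
  have hL := forall_two_smul_eq_zero_baseChange_of_kFourPos W K hs2 h2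
  -- `d_K` is descent-admissible on the all-silent frame (g34 §1)
  have hd := descAdmissible_discr_of_allSilentTwin W hK hodd hH h2K hTam Cd hCd hDEF
  -- a square root of `d_K` in `K`, off `ℚ`
  obtain ⟨θ, hθ, hc⟩ := Literature.NumberTheory.EllipticCurves.exists_sq_eq_discr_not_mem_range K h2
  have hi : θ ^ 2 = ((discr K : ℤ) : K) := by rw [hc, map_intCast]
  -- Kramer's invariant part: `m = res_K x`, `x` in the ∞-relaxed group
  obtain ⟨x, hx, hxm⟩ :=
    (GenusKolyArch.mem_selmerGroup_and_conjAct_eq_iff_exists_mem_relaxed W K hT hd h2 hi hσ₀ m).mp ⟨hm, hσm⟩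
  -- on the cell that group is `Sel₂(E)`
  rw [selmerGroupRelaxedAtInfinityAtTwo_eq_selmerGroup_of_kFourPos W hpos h4] at hx
  refine ⟨x, ⟨hxm, hx⟩, fun y hy ↦ ?_⟩
  exact GenusExact.EigenClassesFinite.resTorsion_injective_of_noTorsion W K h2 hθ hc ((2 : ℕ) : ℤ) hL (hy.1.trans hxm.symm)

omit [W.IsGloballyMinimal] in
/-- **COROLLARY (the reading, kernel form): on the K₄⁺ cell an invariant Selmer class of `E_K` is NON-ZERO iff its unique descent to `Sel₂(E/ℚ)` is.**
For `m ∈ Sel₂(E_K/K)` with `σ₀·m = m` and the unique `s ∈ Sel₂(E/ℚ)` with `res_K s = m`: `m ≠ 0 ↔ s ≠ 0`.  (So a `τ`-invariant Selmer class —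
e.g. a level-1 deep Kolyvagin class `c₁(ℓ)` on the `M₀ ≥ 1` cell — is non-zero iff it REALISES one of the three non-zero classes of `Sel₂(E/ℚ)`.)
[cite: GrossLMS1991, §5 (5.1), §11] [cite: Kramer1981, Thm. 1] -/
theorem ne_zero_iff_of_resTorsion_eq_of_kFourPos (hs2 : W.HasSurjectiveModNGaloisRep 2) (hK : IsImaginaryQuadratic K)
    {s : galH1Torsion W ((2 : ℕ) : ℤ)} {m : galH1Torsion (W.baseChange K) ((2 : ℕ) : ℤ)}
    (hsm : resTorsion W K ((2 : ℕ) : ℤ) s = m) : m ≠ 0 ↔ s ≠ 0 := by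
  have h2 : Module.finrank ℚ K = 2 := hK.1
  have hL := forall_two_smul_eq_zero_baseChange_of_kFourPos W K hs2 h2
  rw [← hsm, Ne, KFourCell.resTorsion_eq_zero_iff W K h2 hL s]

end Summit.BirchSwinnertonDyer.BirchSwinnertonDyer.Theorems.GenusSupplyNarrow.KFourPosCell

end
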